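import Literature.NumberTheory.EllipticCurves.ModularCurve
import Literature.NumberTheory.EllipticCurves.GlobalMinimalModel
import Literature.NumberTheory.EllipticCurves.Rank1Residual.Predicates
import Literature.NumberTheory.DiophantineGeometry.Conductor
import HarnessLib
import HarnessLib.Audit.Tags

/-!
# Candidates E-es-12 / E-es-12′: the Manin constant of EVERY curve divides the exponent of its rational
# torsion (`ManinDividesTorsionExponent`); hence `E[p]` irreducible ⇒ `p ∤ c_E` (`ManinUnitOfIrreducible`) —
# cell `bsd-f2-manin` (D-0131 (3) frontier: the Manin constant at additive primes). `@[conjecture]` leaf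
# (NOTHING asserted; definitions only; the planner's `IsMinimalFor D` is INLINED).

HONEST FRAMING. LENS = Euler-system / explicit-reciprocity (planner `bsd-f2-manin-es` g3, HOME
`run/shared/lean/pub/bsd-f2-manin/MEMO-es.md` §13.10; Props VERBATIM from HOME/es/Sketch-es-g3.lean sha16
9867b1006a8d6be6, namespace `Summit.BirchSwinnertonDyer.BirchSwinnertonDyer.Ideas.ManinESg3`, farm rc 0, with
`IsMinimalFor D := ∀ D′, D.deg ≤ D′.deg` inlined).  THE LAW: the Manin constant of EVERY elliptic curve over `ℚ`
(optimal or not, w.r.t. a MINIMAL-DEGREE `X₀(N)`-parametrisation of the model itself at the conductor) divides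
the EXPONENT of its rational torsion subgroup.  Honesty clause (planner + refuters): the law = Manin (`c₀ = 1`) ⊕
the relative law «`u(ψ_min) ∣ exp W(ℚ)_tors`» (E-es-12ʳ, mechanistic half: μ-type kernels out of `E₀` have
constant duals; not yet typed — T-es-5 residue for the planner); on the 167 semistable gain curves `c₀ = 1` is
Česnavičius 2018 and Serre's `ℤ/p`-or-`μ_p` dichotomy gives the mechanism from print (LEMMA-sized); the 102
additive gain curves (98 × `c = 2` at `4 ∣ N`; 27a3, 27a4, 54a3, 390150gy2 × `c = 3` at `9 ∣ N`) are the part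
with no print cover.  BC5 WITNESS: Cremona `opt_man` × `allgens`, `N < 5·10⁵`: 268 / 269 curves with `c > 1`
satisfy `c ∣ exp E(ℚ)_tors`, the unique failure 390150gy2 (`c = 3`, trivial torsion) being the certified optimality
MISLABEL (leaf `Cremona390150gyNotOptimal`, E-imc-19; es E2X exact-`H₁` certificate j284578) ⇒ 268 / 268;
independently re-counted by refuter-1 (HOME/ref1/es12.py → R17-es12.out 0fe5f70ae2deae8a: 225·2, 41·3, 2·4, 1·5;
extra columns `c ∣ deg(E₀ → E)` 269/269, primes(c) ⊆ isogeny primes 269/269; exponent (not order) load-bearing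
only at 17a2, 32a2 and the `[2,4]` curve).  NOT IN PRINT (refuter-2 g5: no «`c_E ∣ torsion`» statement in corpus
or galaxy; REDUCED for non-CM to `c_W ∣ c₀·[L(E₀) : L(E_*)]` via Vatsal 2005 Thm 1.3 = Stevens 1989 Thm 2.3,
Rem. 1.4, Lemma 1.5, capped by Cremona 2006 Rem. 5.3 statistics; modulo Stevens `c_W ∣ exp E₁(ℚ)_tors`).
Refuter verdicts: REF1 **SURVIVES ×2** (HOME/REFUTER-ref1.md §R17, R-es-8, 18:30Z; compiled verbatim rc 0, CLEAN
×2, 5 read-back examples; note n17a: the Prop carries no finiteness of `E(ℚ)_tors` — `AddMonoid.exponent` of a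
group without finite exponent is the junk value `0` and `c ∣ 0` holds, so the law is VACUOUS on a curve whose
torsion is not known to have finite exponent; finiteness is Mazur/Mordell–Weil, in the tree as facts, and a
consumer should import it); REF2 NOT-IN-PRINT / REDUCED (v6 §B⁶).
-/

noncomputable section

open scoped MatrixGroups ModularForm

open CongruenceSubgroup WeierstrassCurve
  Literature.NumberTheory.EllipticCurves Literature.NumberTheory.EllipticCurves.ModularForms

namespace Summit.BirchSwinnertonDyer.Rank1Residual.ManinAdditive

/-- **Candidate E-es-12 `ManinDividesTorsionExponent` (cell bsd-f2-manin, MEMO-es §13.10; an empirical LAW,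
NOT in print, nothing asserted):** for every globally minimal `W` and every `X₀(N(W))`-datum `D` of `W` of
MINIMAL degree among the data of `W` at its conductor (inlined `IsMinimalFor D`; its `c` is «the» Manin constant
`c_W` up to sign, also for NON-optimal members of the class), `c(D)` divides the exponent of the rational torsion
subgroup `W(ℚ)_tors` (Mathlib `AddMonoid.exponent (AddCommGroup.torsion W.toAffine.Point)`; junk `0` if the
exponent is not finite — see the module docstring, note n17a).  Consequences: `ℓ ∣ c_W ⇒ ℓ ≤ 7` (Mazur), i.e.
Edixhoven's prime list; `W[p]` irreducible ⇒ `p ∤ c_W` (E-es-12′ below).  BC5: 268 / 268 curves with `c > 1`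
below `5·10⁵` after the 390150gy correction.  Why it might fail: a non-optimal curve beyond `5·10⁵` reached from
`E₀` by a `μ`-type isogeny whose Néron scalar exceeds the torsion exponent, or a failure of Manin's `c₀ = 1`.
[cite: Vatsal2005, Thm. 1.3, Rem. 1.4 and Lemma 1.5 (shape only: c_W ∣ c₀·[L(E₀):L(E_*)] for non-CM classes = Stevens 1989 Thm 2.3; the divisibility by the TORSION EXPONENT is NOT in print — cell bsd-f2-manin MEMO-es.md §13.10, E-es-12)]
[cite: Cremona2022ManinConstants, opt_man (the 269-curve c > 1 inventory)] -/
@[conjecture] def ManinDividesTorsionExponent : Prop :=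
  ∀ (W : WeierstrassCurve ℚ) [W.IsElliptic] [W.IsGloballyMinimal] [NeZero (W.conductorNorm ℤ)]
    (D : ModularParametrizationData W (W.conductorNorm ℤ)),
    (∀ D' : ModularParametrizationData W (W.conductorNorm ℤ), D.deg ≤ D'.deg) →
    D.c ∣ (AddMonoid.exponent (AddCommGroup.torsion W.toAffine.Point) : ℤ)

/-- **Candidate E-es-12′ `ManinUnitOfIrreducible` (cell bsd-f2-manin, MEMO-es §13.10; the prime-level
corollary consumed downstream — NOT in print at additive `p ≤ 7`, nothing asserted):** for every globally minimal
`W`, prime `p` and minimal-degree `X₀(N(W))`-datum `D` of `W`, `W[p]` irreducible (tree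
`Literature.NumberTheory.EllipticCurves.Rank1Residual.Irr W p`) ⇒ `p ∤ c(D)`.  (E-es-12 ⇒ this, since a rational
point of order `p` makes `W[p]` reducible; the Manin input of the BSD_p closers' crux 20483 at every `p`.)
[cite: Vatsal2005, Thm. 1.3 and Lemma 1.5 (shape only; «irreducible ⇒ p ∤ c_W for every member» at additive p is NOT in print — cell bsd-f2-manin MEMO-es.md §13.10, E-es-12′; at p ≥ 11 the optimal-curve case is Edixhoven 1991 Thm 3)]
[cite: EdixhovenManin1991, Thm. 3] -/
@[conjecture] def ManinUnitOfIrreducible : Prop :=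
  ∀ (W : WeierstrassCurve ℚ) [W.IsElliptic] [W.IsGloballyMinimal] [NeZero (W.conductorNorm ℤ)]
    (p : ℕ) [Fact p.Prime] (D : ModularParametrizationData W (W.conductorNorm ℤ)),
    (∀ D' : ModularParametrizationData W (W.conductorNorm ℤ), D.deg ≤ D'.deg) →
    Literature.NumberTheory.EllipticCurves.Rank1Residual.Irr W p → ¬ (p : ℤ) ∣ D.c

end Summit.BirchSwinnertonDyer.Rank1Residual.ManinAdditive

end
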